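import Summits.BirchSwinnertonDyer.BirchSwinnertonDyer.Theses.ManinLocalTwoThree
import Literature.NumberTheory.EllipticCurves.KatoAdditiveTwistedValueNeronIntegrality
import HarnessLib

/-!
# Crux `ManinLocalTwoThree.ManinPrimeToAdditiveFiveLe` (stmt-BirchSwinnertonDyer-22969) — line «tame-twist-mu»
# (ideator bsd-idea-8 g2, lens nearmiss; W-71 crux-level skeleton; BSD is not proved by any of this)

THE NEAR-MISS.  Let `E₀/ℚ` be the optimal curve of the newform `f` of level `N` with `p² ∣ N`, `p ≥ 5`
(so `E₀` is ADDITIVE at `p`), `c₀ = c(D)` its Manin constant (`Λ_{E₀} = c₀ Λ_f`).  Call a Dirichlet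
character `χ` of conductor `m` TAME-ADMISSIBLE at `(p, N)` if `(m, pN) = 1`, `χ` primitive, `χ ≠ 1`,
`p ∤ ord χ` (and, only when `p ∈ {5, 7}`, `gcd(ord_m p, p − 1) = 1`).  Its `N`-imprimitive Birch–Manin value
in the units of the NEWFORM is the cyclotomic integer (up to a prime-to-`p` denominator)
  `r_χ := ∏_{ℓ ∥ N} (ℓ − a_ℓ χ(ℓ))(ℓ − a_ℓ χ̄(ℓ)) · Σ_{a mod m} χ(a) {∞, a/m}_f / Ω_f^{sgn χ}`   (`Ω⁻_f · i` for odd `χ`),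
computable EXACTLY by modular symbols.  Kato's integral zeta elements `_{c,d} z_m^{(p)}(f, 1, 1, ξ, S)`
((8.1.3)), their `exp*` (Thm. 9.7) and `χ`-parts (Thm. 6.6), read in NÉRON units at the additive prime through
the Kim–Nakamura receptacle `exp*(H¹/H¹_f) = O_K ω_E` (Cor. 2.4 ⟸ Kosters–Pannekoek Thm. 1; every `p > 7`,
and `p ∈ {5,7}` off the exceptional locus `E(ℚ_p)[p] ≠ 0`) — the tree's NAMED FACT
`kato_neron_isIntegral_twistedSymbolSum_of_additive_five_le` (a derived reading, no Manin binder) — give,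
for the optimal curve with `E₀[p]` irreducible,
  **`ord_p c₀ ≤ μ_p^{tame}(f) := min over tame-admissible χ and primes 𝔭 ∣ p of v_𝔭(r_χ)`**      (★)
(the period scalar `ϖ = Ω⁺_f/Ω(E₀)` has `ord_p ϖ = −ord_p c₀`, tree theorem
`ManinFrameResidueProperRUnitTwist.padicValRat_eq_neg_of_mul_realPeriodRat_eq`, and the fact says `ϖ · r_χ`
is `p`-integral).  MEASURED DEFICIT = the tame twisted `μ`-invariant `μ_p^{tame}(f) ≥ 0` of the newform;
SINGLE INPUT TO IMPROVE = `μ_p^{tame}(f) = 0`, i.e. ONE tame-admissible `χ` with `r_χ` a unit at some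
prime above `p` (stub A).  Then `p ∤ c₀` on the irreducible, non-exceptional locus (stubs B + C); the Borel
locus (`E[p]` reducible) and the Kosters–Pannekoek exceptional locus at `p ∈ {5,7}` are residual stubs D1, D2.

WHY THIS IS A DIFFERENT LEVER (vs the lines of record on this crux).  `upper_anchor` (g0, PICKED) and
`neron_smooth` (bsd-idea-19) live at `p` itself: twist orbit under `χ_p`, lattice-direction law, stable /
Néron models of `X₀(p²M)` and of `E`, Lie-algebra witnesses.  Here NOTHING happens at `p` geometrically:
the probes are twists by characters of conductor PRIME TO `pN` and order prime to `p` (they do not change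
the local type at `p`), the engine is an Euler system, and the hard stub is a statement about the modular
symbol of `f` modulo `p` ALONE — no integral model of `X₀(N)`, no `deg φ`, no Kodaira symbol, no Néron model
of `J₀(N)`.  Currency of stub A = mod-`p` NON-VANISHING of tame twists (Ash–Stevens 1986, Stevens 1989,
Vatsal 1999, Kim–Sun, Sun AJM 2019, Lee–Sun JEMS: all printed for `p ∤ N`; at `p² ∣ N` open in print,
decidable per pair).  For a PRIME conductor `q ∤ pN`, `q ≢ 1 (mod p)`, every `χ ≠ 1 (mod q)` is
tame-admissible and orthogonality on `(ℤ/q)ˣ` turns "all `r_χ ≡ 0`" into "`b ↦ [b/q]^±_f` is constant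
mod 𝔭 up to ≤ 2·#{ℓ ∥ N} characters" — the attack is homological (Manin symbols generate `H₁`), not
analytic.  Nearest in-project use of the engine: cell `bsd-wall`, crux stmt-20709 (`AdditiveKolyvaginRoad.
ManinFrameResidueProperR`), crux-idea `kato-kp-unit-twist`, theorems
`ManinFrameResidueProperRUnitTwist.not_dvd_c_of_unitQuadraticTwist` / `forall_latticeOptimal_…` — QUADRATIC
`χ`, `p > 7`, target TDS; per-curve K4 found for 273/273 optimal curves (`p ≥ 11`, `p² ∣ N ≤ 2400`).  Delta
here: target C5 itself for all `p ≥ 5` via the `_five_le` reading; characters of ANY order prime to `p`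
(the orthogonality/homology attack exists only for these); the deficit `μ_p^{tame}` made the explicit
single input; residual loci isolated as stubs.

STUBS (5) and COMPOSITION (sorry-free): `ManinPrimeToAdditiveFiveLe_of : A → B → C → D1 → D2 → crux`.
HONEST PRICE (declared): (P1) stub A is NOT implied by the crux (a unit tame twist is more than `p ∤ c₀`
needs) — it is a genuine sufficient condition, open class-wide at `p² ∣ N`, decidable per pair; (P2) stub C
is the tree's DERIVED READING of Kato + Kim–Nakamura + Kosters–Pannekoek (size XL, flagged for a referee in
its own docstring) — the line is CONDITIONAL on it exactly as the `bsd-wall` theorems are; (P3) D1/D2 are the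
crux on strict sub-loci (Borel image: Stevens–Tang–Vatsal isogeny-graph tools, overlap KP57 stmt-23810 and
`upper_anchor.stub_reducibleTwistMinimal` at `p ∈ {5,7}`; KP-exceptional `p ∈ {5,7}`: after Edixhoven's
printed cases a sub-case of K★ stmt-22226 / `upper_anchor`).  BSD is not proved by any of this.
-/

set_option autoImplicit false

noncomputable section

open scoped MatrixGroups ModularForm Classical

open CongruenceSubgroup Literature.NumberTheory.EllipticCurves
  Literature.NumberTheory.EllipticCurves.ModularForms

namespace Summit.BirchSwinnertonDyer.BirchSwinnertonDyer.Cruxes.ManinPrimeToAdditiveFiveLe.TameTwistMu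

/-- **Tame unit-twist datum** `U(W, f, p)` at level `N`: a modulus `m` prime to `pN` (with
`gcd(ord_m p, p − 1) = 1` unless `p > 7`), a primitive non-trivial Dirichlet character `χ mod m` of order
prime to `p`, and the number `r` defined by the `N`-imprimitive Birch–Manin identity in the units of `f`
(even: `Ω⁺_f`; odd: `Ω⁻_f · i`), such that `r` is a UNIT AT SOME PRIME ABOVE `p`: no prime-to-`p` multiple of
`r / p` is an algebraic integer (for `r` in the cyclotomic field `ℚ(χ)`, unramified at `p`, this says
`v_𝔭(r) ≤ 0` for some `𝔭 ∣ p`).  The Euler factors and the symbol sum are exactly those of the fact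
`kato_neron_isIntegral_twistedSymbolSum_of_additive_five_le`.  `μ_p^{tame}(f) = 0` ⟺ such a datum exists.
A predicate; nothing asserted. [cite: Kato2004Asterisque, Thm. 6.6 (1) (p. 163)] [cite: MazurTateTeitelbaum1986, §I.8 (8.6)] -/
def HasTameUnitTwist (W : WeierstrassCurve ℚ) [W.IsElliptic] {N : ℕ} [NeZero N]
    (f : CuspForm (Gamma0 N) 2) (p : ℕ) : Prop :=
  ∃ (m : ℕ) (_ : NeZero m), m.Coprime (p * N) ∧ (7 < p ∨ Nat.Coprime (orderOf (p : ZMod m)) (p - 1)) ∧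
    ∃ χ : DirichletCharacter ℂ m, χ.IsPrimitive ∧ χ ≠ 1 ∧ ¬ p ∣ orderOf χ ∧
      ∃ r : ℂ, (¬ ∃ s : ℕ, ¬ p ∣ s ∧ IsIntegral ℤ ((s : ℂ) * r / p)) ∧
        ((χ.Even ∧
            (∏ ℓ ∈ N.primeFactors with ¬ ℓ ^ 2 ∣ N,
                (((ℓ : ℂ) - (W.LFunction ℓ : ℂ) * χ (ℓ : ZMod m)) *
                  ((ℓ : ℂ) - (W.LFunction ℓ : ℂ) * (χ (ℓ : ZMod m))⁻¹))) *
              twistedSymbolSum f χ = r * (plusPeriod f : ℂ)) ∨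
          (χ.Odd ∧
            (∏ ℓ ∈ N.primeFactors with ¬ ℓ ^ 2 ∣ N,
                (((ℓ : ℂ) - (W.LFunction ℓ : ℂ) * χ (ℓ : ZMod m)) *
                  ((ℓ : ℂ) - (W.LFunction ℓ : ℂ) * (χ (ℓ : ZMod m))⁻¹))) *
              twistedSymbolSum f χ = r * (minusPeriod f : ℂ) * Complex.I))

/-- STUB A — THE HARD STUB (class-wide, OPEN at `p² ∣ N`; the single input of the near-miss):
`μ_p^{tame}(f) = 0` — every newform `f` of an elliptic curve `W/ℚ` at a level `N` with `p² ∣ N`, `p ≥ 5`,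
`W[p]` irreducible, has ONE tame-admissible character with unit `N`-imprimitive Birch–Manin value in the
units of `f`.  Per pair DECIDABLE (exact modular symbols; a search over prime conductors `q ∤ pN`,
`q ≢ 1 mod p`, terminates in practice at tiny `q`).  Class-wide: for a prime conductor `q` all `χ ≠ 1` are
admissible, and by orthogonality on `(ℤ/q)ˣ` (order prime to `p`) the failure of every `χ mod q` forces
`b ↦ [b/q]^±_f (mod 𝔭)` into the span of `≤ 1 + 2·#{ℓ ∥ N}` characters; failure for ALL such `q` is a
rigid degeneracy of the modular symbol of `f` mod `p` along prime-denominator cusps, to be contradicted by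
Manin-symbol generation of `H₁(X₀(N), cusps; ℤ)` (Ash–Stevens / Kim–Sun style) — printed only for `p ∤ N`.
Why it might fail: a newform whose `±`-symbol is identically `0 mod p` on all prime-denominator cusps with
`q ≢ 1 (p)` without being Eisenstein mod `p` (no example known; Lee–Sun's mod-`p` equidistribution says the
opposite generically).  [cite: AshStevens1986Duke] [cite: Kato2004Asterisque, Thm. 6.6 (1)]
[cite: MazurTateTeitelbaum1986, §I.8 (8.6)] [lit: paper:arxiv-1902.06277 §1.1, Thm. 1 (p ∤ 2N)] -/
theorem stub_hasTameUnitTwist :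
    ∀ (W : WeierstrassCurve ℚ) [W.IsElliptic] [W.IsGloballyMinimal] {N : ℕ} [NeZero N]
      (f : CuspForm (Gamma0 N) 2), IsNewformOf W f →
      ∀ (p : ℕ) [Fact p.Prime], 5 ≤ p → p ^ 2 ∣ N → W.HasIrreducibleModPGaloisRep p →
      HasTameUnitTwist W f p := by
  sorry

/-- STUB B — ENGINE (size M, closable NOW): granted the fact (its first hypothesis), ONE tame unit twist at a
LATTICE-OPTIMAL datum `D` (`Λ_E = c Λ_f`) of a globally minimal `W`, additive at `p ≥ 5` (`p² ∣ N`, `N` =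
level of the newform = conductor), `W[p]` irreducible, off the exceptional locus when `p ≤ 7`, forces
`p ∤ c(D)`: the fact gives `s · ϖ · r` integral with `p ∤ s` for the rational period scalar `ϖ` with
`ϖ Ω(W) = Ω⁺_f` (resp. `ϖ |Ω⁻(W)| = Ω⁻_f`; `ϖ = m'/|c|`, `m' ∣ 2`, tree
`SkinnerUrban2014.exists_dvd_two_mul_realPeriodRat_eq_of_latticeEq`), `ord_p ϖ = −ord_p c` (tree
`ManinFrameResidueProperRUnitTwist.padicValRat_eq_neg_of_mul_realPeriodRat_eq` / `…imaginaryPeriodRat…`), and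
if `ord_p c ≥ 1` then `s·|numerator| · r / p` would be integral, contradicting the unit clause.  Pattern:
`ManinFrameResidueProperRUnitTwist.not_dvd_c_of_unitQuadraticTwist` (quadratic `χ`, `p > 7`) generalised to
any order prime to `p` and the `_five_le` reading; `p² ∣ N ⇒ ¬good ∧ ¬multiplicative` from `IsNewformOf`
(level = conductor).  [cite: Kato2004Asterisque, (8.1.3), Thm. 9.7] [cite: KimNakamura2020, Cor. 2.4]
[cite: KostersPannekoek2017, Thm. 1] -/
theorem stub_not_dvd_maninConstant_of_tameUnitTwist :
    kato_neron_isIntegral_twistedSymbolSum_of_additive_five_le →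
    ∀ (W : WeierstrassCurve ℚ) [W.IsElliptic] [W.IsGloballyMinimal] {N : ℕ} [NeZero N]
      (D : ModularParametrizationData W N),
      (∀ z ∈ D.L.lattice, ∃ w ∈ periodLattice D.f, z = D.c * w) →
      ∀ (p : ℕ) [Fact p.Prime], 5 ≤ p → p ^ 2 ∣ N → W.HasIrreducibleModPGaloisRep p →
      (7 < p ∨ ∀ P : (W.baseChange ℚ_[p]).toAffine.Point, p • P = 0 → P = 0) →
      HasTameUnitTwist W D.f p → ¬ (p : ℤ) ∣ D.maninConstant := by
  sorry

/-- STUB C — THE CONDITIONAL INPUT (size XL; a port, not research): the tree's named fact = Kato (8.1.3) +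
Thm. 9.7 + Thm. 6.6 (1) + Thm. 13.6 read in Néron units at an additive `p ≥ 5` through Kim–Nakamura Cor. 2.4
and Kosters–Pannekoek Thm. 1 (derived reading; non-verbatim steps listed in the fact's docstring: lattice
transfer under irreducibility, functoriality of the comparison isomorphisms under the optimal
parametrisation, unit choice, the norm computation at `p ≤ 7`).  Exposed as its own stub so that the line's
conditionality is visible in the skeleton and stub B is closable outright.
[cite: Kato2004Asterisque, (8.1.3) (p. 180), Thm. 9.7 (p. 189), Thm. 6.6 (1) (p. 163), Thm. 13.6]
[cite: KimNakamura2020, Thm. 2.1, Cor. 2.4] [cite: KostersPannekoek2017, Thm. 1 and Cor. 2] -/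
theorem stub_katoNeronReading_five_le :
    kato_neron_isIntegral_twistedSymbolSum_of_additive_five_le := by
  sorry

/-- STUB D1 — RESIDUAL, BOREL LOCUS (open; different tools): Manin's `p`-part at a lattice-optimal datum of
level `N`, `p² ∣ N`, `p ≥ 5`, when `W[p]` is REDUCIBLE (rational `p`-isogeny: by Mazur `p ∈ {5, 7, 13}` in
infinite `j`-families, `p ∈ {11, 17, 37}` finitely many `j`, `p ∈ {19, 43, 67, 163}` CM `j` only).  Here
Kato's lattice `V_{O_λ}(f)` is pinned to ONE member of the isogeny class (no homothety), so the unit-twist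
certificate lands on that member; transport to the optimal curve is the isogeny-graph problem of
Stevens (1989) / Tang (1997) / Vatsal (2005) ("the `X₁`-optimal curve and `μ`-type kernels").  Overlaps
KP57 (stmt-BirchSwinnertonDyer-23810) and `upper_anchor.stub_reducibleTwistMinimal` at `p ∈ {5,7}`.
[cite: EdixhovenManin1991, Thm. 3] [lit: paper:doi-10-1017-s147474800500006x (Vatsal 2005)] -/
theorem stub_borelResidual :
    ∀ (W : WeierstrassCurve ℚ) [W.IsElliptic] [W.IsGloballyMinimal] {N : ℕ} [NeZero N]
      (D : ModularParametrizationData W N),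
      (∀ z ∈ D.L.lattice, ∃ w ∈ periodLattice D.f, z = D.c * w) →
      ∀ (p : ℕ) [Fact p.Prime], 5 ≤ p → p ^ 2 ∣ N → ¬ W.HasIrreducibleModPGaloisRep p →
      ¬ (p : ℤ) ∣ D.maninConstant := by
  sorry

/-- STUB D2 — RESIDUAL, KOSTERS–PANNEKOEK EXCEPTIONAL LOCUS at `p ∈ {5, 7}` (open): `W[p]` irreducible
but `W(ℚ_p)[p] ≠ 0` (for additive `W` at `p ≥ 5`: `E₀(ℚ_p) ≅ ℤ_p × ℤ/p`, i.e. `a₄ ≡ 10 (mod 25)` resp.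
`a₆ ≡ 14 (mod 49)` in the Kosters–Pannekoek normal form) — there the Kim–Nakamura receptacle loses a factor
`p` over every unramified `K_v` and (★) degrades to Edixhoven's `ord_p c₀ ≤ 1`.  After Edixhoven's printed
cases (`p ∤ c₀` unless the reduction at `p` is potentially ordinary of Kodaira type II, III or IV) what is
left is a sub-case of K★ (stmt-BirchSwinnertonDyer-22226) / `upper_anchor.stub_upperAnchor` at
`p ∈ {5, 7}`.  [cite: KostersPannekoek2017, Cor. 2] [cite: EdixhovenManin1991, Thm. 3] -/
theorem stub_kpExceptionalResidual :
    ∀ (W : WeierstrassCurve ℚ) [W.IsElliptic] [W.IsGloballyMinimal] {N : ℕ} [NeZero N]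
      (D : ModularParametrizationData W N),
      (∀ z ∈ D.L.lattice, ∃ w ∈ periodLattice D.f, z = D.c * w) →
      ∀ (p : ℕ) [Fact p.Prime], 5 ≤ p → p ≤ 7 → p ^ 2 ∣ N → W.HasIrreducibleModPGaloisRep p →
      (∃ P : (W.baseChange ℚ_[p]).toAffine.Point, p • P = 0 ∧ P ≠ 0) →
      ¬ (p : ℤ) ∣ D.maninConstant := by
  sorry

/-- **COMPOSITION (kernel-checked, no `sorry`): A → B → C → D1 → D2 → `ManinPrimeToAdditiveFiveLe`.**
The crux's four fact-hypotheses (Mazur / Abbes–Ullmo / Česnavičius at semistable primes, modularity) are not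
needed at an additive `p ≥ 5` and are discarded; split on `W[p]` irreducible (else D1), then on
`7 < p ∨ W(ℚ_p)[p] = 0` (else D2), then A supplies the tame unit twist and B (granted C) concludes. -/
theorem ManinPrimeToAdditiveFiveLe_of
    (hA : ∀ (W : WeierstrassCurve ℚ) [W.IsElliptic] [W.IsGloballyMinimal] {N : ℕ} [NeZero N]
      (f : CuspForm (Gamma0 N) 2), IsNewformOf W f →
      ∀ (p : ℕ) [Fact p.Prime], 5 ≤ p → p ^ 2 ∣ N → W.HasIrreducibleModPGaloisRep p →
      HasTameUnitTwist W f p)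
    (hB : kato_neron_isIntegral_twistedSymbolSum_of_additive_five_le →
      ∀ (W : WeierstrassCurve ℚ) [W.IsElliptic] [W.IsGloballyMinimal] {N : ℕ} [NeZero N]
      (D : ModularParametrizationData W N),
      (∀ z ∈ D.L.lattice, ∃ w ∈ periodLattice D.f, z = D.c * w) →
      ∀ (p : ℕ) [Fact p.Prime], 5 ≤ p → p ^ 2 ∣ N → W.HasIrreducibleModPGaloisRep p →
      (7 < p ∨ ∀ P : (W.baseChange ℚ_[p]).toAffine.Point, p • P = 0 → P = 0) →
      HasTameUnitTwist W D.f p → ¬ (p : ℤ) ∣ D.maninConstant)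
    (hC : kato_neron_isIntegral_twistedSymbolSum_of_additive_five_le)
    (hD1 : ∀ (W : WeierstrassCurve ℚ) [W.IsElliptic] [W.IsGloballyMinimal] {N : ℕ} [NeZero N]
      (D : ModularParametrizationData W N),
      (∀ z ∈ D.L.lattice, ∃ w ∈ periodLattice D.f, z = D.c * w) →
      ∀ (p : ℕ) [Fact p.Prime], 5 ≤ p → p ^ 2 ∣ N → ¬ W.HasIrreducibleModPGaloisRep p →
      ¬ (p : ℤ) ∣ D.maninConstant)
    (hD2 : ∀ (W : WeierstrassCurve ℚ) [W.IsElliptic] [W.IsGloballyMinimal] {N : ℕ} [NeZero N]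
      (D : ModularParametrizationData W N),
      (∀ z ∈ D.L.lattice, ∃ w ∈ periodLattice D.f, z = D.c * w) →
      ∀ (p : ℕ) [Fact p.Prime], 5 ≤ p → p ≤ 7 → p ^ 2 ∣ N → W.HasIrreducibleModPGaloisRep p →
      (∃ P : (W.baseChange ℚ_[p]).toAffine.Point, p • P = 0 ∧ P ≠ 0) →
      ¬ (p : ℤ) ∣ D.maninConstant) :
    Summit.BirchSwinnertonDyer.BirchSwinnertonDyer.Theses.ManinLocalTwoThree.ManinPrimeToAdditiveFiveLe := by
  intro _hMazur _hAU _hCes _hNew W _ _ N _ D hopt p hp h5 hpN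
  haveI : Fact p.Prime := ⟨hp⟩
  by_cases hirr : W.HasIrreducibleModPGaloisRep p
  · by_cases htors : (7 < p ∨ ∀ P : (W.baseChange ℚ_[p]).toAffine.Point, p • P = 0 → P = 0)
    · exact hB hC W D hopt p h5 hpN hirr htors (hA W D.f D.isNewformOf p h5 hpN hirr)
    · have hp7 : p ≤ 7 := by
        by_contra h
        exact htors (Or.inl (by omega))
      have hP : ∃ P : (W.baseChange ℚ_[p]).toAffine.Point, p • P = 0 ∧ P ≠ 0 := by
        by_contra h
        push_neg at h
        exact htors (Or.inr h)
      exact hD2 W D hopt p h5 hp7 hpN hirr hP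
  · exact hD1 W D hopt p h5 hpN hirr

/-- The same composition with the registered stubs plugged in (its only `sorry`s are the stubs'). -/
theorem ManinPrimeToAdditiveFiveLe_of_stubs :
    Summit.BirchSwinnertonDyer.BirchSwinnertonDyer.Theses.ManinLocalTwoThree.ManinPrimeToAdditiveFiveLe :=
  ManinPrimeToAdditiveFiveLe_of stub_hasTameUnitTwist stub_not_dvd_maninConstant_of_tameUnitTwist
    stub_katoNeronReading_five_le stub_borelResidual stub_kpExceptionalResidual

end Summit.BirchSwinnertonDyer.BirchSwinnertonDyer.Cruxes.ManinPrimeToAdditiveFiveLe.TameTwistMu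

end
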